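import Mathlib
import Summits.AtomisticToContinuum.Crystallization.Theses.PhononSlackCertificates
import Summits.AtomisticToContinuum.Crystallization.Theorems.PhononSlackCertificatesNearFarGlueRLooseExhaustion
import Summits.AtomisticToContinuum.Crystallization.Theorems.PhononSlackCertificatesNearFarGlueRStructure
import Summits.AtomisticToContinuum.Crystallization.Theorems.PhononSlackCertificatesNearFarGlueRReductionTight
import Summits.AtomisticToContinuum.Crystallization.Theorems.NearFarGlueR.Negative.GlueToolkit
import Summits.AtomisticToContinuum.Crystallization.Theorems.PhononSlackCertificatesNearFarGlueRFibre
import Literature.MathematicalPhysics.StatisticalMechanics.LennardJonesClusters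

/-!
# Crux `PhononSlackCertificates.NearFarGlueR` (stmt-AtomisticToContinuum-14970), line `Sketch`:
the residual may assume NET-BOUND, `3/10`-separated configurations

Continuation lead c3; part 3b of the loose-particle species (registered sub-goal
`stub_looseReduction` of the crux item).  By loose exhaustion (part 3a: `exists_netBound_core`,
`sep_of_netBound`) every finite injective configuration `x` has a net-bound — hence
`3/10`-separated — sub-configuration `x ∘ f` reached at no cost: each stripped particle pays `0.711`
against `N·e*`.  Here the tight contacts are transferred (`card_contact_le_strip`):
`#T(x) ≤ 5833·(N − K) + #T(x ∘ f)`, `T` = bad particles within `21/20` of a good one — a contact of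
`x` is stripped, or lies within `51/20` of a stripped particle (at most `(2·(51/20)/(3/10) + 1)³ =
5832` kept particles per stripped one, `fibre_count_on`), or keeps its whole `3/2`-neighbourhood and
that of its good partner, so it is a contact of `x ∘ f` (`good_of_good_comp`,
`good_comp_of_good_far`).  Consequences:

* `tightContact_ineq_of_netBound`, `tightContact_ineq_of_sep`: if the residual's inequality
  `K·e* + g·#T(z) ≤ 𝓔(z)` holds with ONE `g ≥ 0` for every net-bound (a fortiori for every
  `3/10`-separated) injective `z`, then `N·e* + min g (711/5834000)·#T(x) ≤ 𝓔(x)` for EVERY finite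
  injective `x` — no separation hypothesis at all;
* `tightContactGap_iff_sep`, `tightContactGap_iff_netBound`: the registered residual
  `stub_tightContactGap` (`∀ δ > 0 ∃ g₂(δ) > 0 …`) is EQUIVALENT to its single instance `δ = 3/10`
  and to its net-bound instance, and then holds with a δ-independent constant.

So the route's `∀ δ` adversary (dense `δ`-clouds and crowding — the mechanism that refuted
`FarFieldGap` and the pointwise contact gap) is no part of the residual's content; whoever attacks
the promoted crux may assume every particle net-bound (`A_j < 0`) and all distances `≥ 3/10`.
(For the TARGET the separation removal is the tree's `coerciveTwoShellGap_iff_sepTwoShellGap`, by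
closest-pair deletion; the net-bound normalisation is new.)  All `[folklore]`.
-/

noncomputable section

namespace Summit.AtomisticToContinuum.Crystallization.Theorems.PhononSlackCertificatesNearFarGlueR

open Literature.MathematicalPhysics.StatisticalMechanics
open Literature.Geometry.DiscreteGeometry
open Summit.AtomisticToContinuum.Crystallization.Theses.PhononSlackCertificates
open Summit.AtomisticToContinuum.Crystallization.Theorems.NearFarGlueRNegative (good_of_good_comp)
open scoped BigOperators

/-! ## §1 Transfer of tight contacts -/

/-- **Tight-contact count under loose exhaustion.**  For `f : Fin K ↪ Fin N` with `x ∘ f`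
`3/10`-separated: `#T(x) ≤ 5833·(N − K) + #T(x ∘ f)`, `T` = bad particles within `21/20` of a good
one — a contact of `x` is stripped, or within `51/20` of a stripped particle (`≤ 18³ = 5832` per
stripped particle), or its whole `3/2`-neighbourhood and that of its good partner are kept, so it is a
contact of `x ∘ f`. [folklore] -/
theorem card_contact_le_strip {N K : ℕ} (x : Fin N → EuclideanSpace ℝ (Fin 3)) (f : Fin K ↪ Fin N)
    (hsep : ∀ k l : Fin K, k ≠ l → (3 / 10 : ℝ) ≤ dist (x (f k)) (x (f l))) :
    (Nat.card {j : Fin N // ¬ IsTwoShellGood (1 / 20) (47 / 50) 1 x j ∧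
        ∃ i : Fin N, IsTwoShellGood (1 / 20) (47 / 50) 1 x i ∧ dist (x i) (x j) ≤ 21 / 20} : ℝ) ≤
      5833 * ((N : ℝ) - K) +
        (Nat.card {k : Fin K // ¬ IsTwoShellGood (1 / 20) (47 / 50) 1 (x ∘ f) k ∧
          ∃ i : Fin K, IsTwoShellGood (1 / 20) (47 / 50) 1 (x ∘ f) i ∧
            dist ((x ∘ f) i) ((x ∘ f) k) ≤ 21 / 20} : ℝ) := by
  classical
  set Rm : Finset (Fin N) := (Finset.univ.map f)ᶜ with hRm
  set Tx := Finset.univ.filter fun j : Fin N => ¬ IsTwoShellGood (1 / 20) (47 / 50) 1 x j ∧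
      ∃ i : Fin N, IsTwoShellGood (1 / 20) (47 / 50) 1 x i ∧ dist (x i) (x j) ≤ 21 / 20 with hTx
  set Tz := Finset.univ.filter fun k : Fin K => ¬ IsTwoShellGood (1 / 20) (47 / 50) 1 (x ∘ f) k ∧
      ∃ i : Fin K, IsTwoShellGood (1 / 20) (47 / 50) 1 (x ∘ f) i ∧
        dist ((x ∘ f) i) ((x ∘ f) k) ≤ 21 / 20 with hTz
  set S := (Finset.univ.map f).filter fun j : Fin N => ∃ w ∈ Rm, dist (x j) (x w) ≤ 51 / 20 with hS
  rw [Nat.card_eq_fintype_card, Fintype.card_subtype, Nat.card_eq_fintype_card, Fintype.card_subtype]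
  change ((Tx.card : ℕ) : ℝ) ≤ 5833 * ((N : ℝ) - K) + ((Tz.card : ℕ) : ℝ)
  have hRmcard : (Rm.card : ℝ) = (N : ℝ) - K := by
    rw [hRm, Finset.card_compl, Finset.card_map, Finset.card_univ, Fintype.card_fin, Fintype.card_fin,
      Nat.cast_sub (by simpa using (Finset.univ.map f).card_le_univ)]
  have hrange : ∀ j : Fin N, j ∉ Rm ↔ j ∈ Set.range f := fun j => by
    simp only [hRm, Finset.mem_compl, not_not, Finset.mem_map, Finset.mem_univ, true_and,
      Set.mem_range]
  -- fibre count for S (kept particles near a stripped one)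
  have hSle : (S.card : ℝ) ≤ (2 * (51 / 20) / (3 / 10) + 1) ^ 3 * (Rm.card : ℝ) := by
    refine fibre_count_on (by norm_num) (by norm_num) x S Rm (fun i hi j hj hij => ?_) fun j hj => ?_
    · obtain ⟨k, -, rfl⟩ := Finset.mem_map.1 (Finset.mem_filter.1 hi).1
      obtain ⟨l, -, rfl⟩ := Finset.mem_map.1 (Finset.mem_filter.1 hj).1
      exact hsep k l fun h => hij (by rw [h])
    · obtain ⟨w, hw, hd⟩ := (Finset.mem_filter.1 hj).2
      exact ⟨w, hw, hd⟩
  have h18 : (2 * (51 / 20 : ℝ) / (3 / 10) + 1) ^ 3 = 5832 := by norm_num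
  rw [h18] at hSle
  -- cover Tx
  have hcover : Tx ⊆ Rm ∪ S ∪ Tz.map f := by
    intro j hj
    obtain ⟨hbad, i, hgood, hd⟩ := (Finset.mem_filter.1 hj).2
    by_cases hjR : j ∈ Rm
    · exact Finset.mem_union_left _ (Finset.mem_union_left _ hjR)
    · have hjf : j ∈ Finset.univ.map f := by
        simpa [hRm] using hjR
      by_cases hsp : ∃ w ∈ Rm, dist (x j) (x w) ≤ 51 / 20
      · exact Finset.mem_union_left _ (Finset.mem_union_right _ (Finset.mem_filter.2 ⟨hjf, hsp⟩))
      · push Not at hsp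
        obtain ⟨k, rfl⟩ := (hrange _).1 hjR
        -- the good partner i is kept as well (it is within 21/20 < 51/20 of x (f k))
        have hiR : i ∉ Rm := fun hiR => by
          have := hsp i hiR
          rw [dist_comm] at hd
          linarith
        obtain ⟨m, rfl⟩ := (hrange _).1 hiR
        refine Finset.mem_union_right _ (Finset.mem_map.2 ⟨k, Finset.mem_filter.2
          ⟨Finset.mem_univ _, ?_, m, ?_, by simpa using hd⟩, rfl⟩)
        · -- k stays bad: removed particles are far from x (f k)
          intro hgood'
          refine hbad (good_of_good_comp x f k (fun w hw => ?_) hgood')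
          have hwR : w ∈ Rm := by
            by_contra h; exact hw ((hrange w).1 h)
          have := hsp w hwR
          rw [dist_comm]; linarith
        · -- m stays good: removed particles are far from x (f m)
          refine good_comp_of_good_far x f m (fun w hw => ?_) hgood
          have hwR : w ∈ Rm := by
            by_contra h; exact hw ((hrange w).1 h)
          have h1 : 51 / 20 < dist (x w) (x (f k)) := by rw [dist_comm]; exact hsp w hwR
          -- dist (x w) (x (f k)) ≤ dist (x w) (x (f m)) + dist (x (f m)) (x (f k))
          have htri := dist_triangle (x w) (x (f m)) (x (f k))
          linarith
  have h1 : Tx.card ≤ (Rm ∪ S).card + (Tz.map f).card :=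
    (Finset.card_le_card hcover).trans (Finset.card_union_le _ _)
  have h2 : (Rm ∪ S).card ≤ Rm.card + S.card := Finset.card_union_le _ _
  have h3 : (Tz.map f).card = Tz.card := Finset.card_map _
  have h4 : (Tx.card : ℝ) ≤ Rm.card + S.card + Tz.card := by
    have : Tx.card ≤ Rm.card + S.card + Tz.card := by omega
    exact_mod_cast this
  rw [hRmcard] at hSle h4
  linarith

/-! ## §2 The reductions -/

/-- **The residual reduces to net-bound configurations.**  If `K·e* + g·#T(z) ≤ 𝓔(z)` for every
NET-BOUND injective `z` (`A_k(z) < 0` for all `k`; such `z` are `3/10`-separated) with one `g ≥ 0`,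
then `N·e* + min g (711/5834000)·#T(x) ≤ 𝓔(x)` for EVERY finite injective `x`. [folklore] -/
theorem tightContact_ineq_of_netBound {g : ℝ} (hg : 0 ≤ g)
    (H : ∀ (K : ℕ) (z : Fin K → EuclideanSpace ℝ (Fin 3)), Function.Injective z →
      (∀ k : Fin K, ∑ l ∈ Finset.univ.erase k,
        (min (lennardJones (dist (z k) (z l))) 0 + (1 / 2 : ℝ) * max (lennardJones (dist (z k) (z l))) 0) < 0) →
      (K : ℝ) * (⨅ Q : PeriodicConfiguration 3, Q.energyPerParticle lennardJones) +
          g * (Nat.card {k : Fin K // ¬ IsTwoShellGood (1 / 20) (47 / 50) 1 z k ∧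
            ∃ i : Fin K, IsTwoShellGood (1 / 20) (47 / 50) 1 z i ∧ dist (z i) (z k) ≤ 21 / 20} : ℝ) ≤
        interactionEnergy lennardJones z)
    {N : ℕ} (x : Fin N → EuclideanSpace ℝ (Fin 3)) (hx : Function.Injective x) :
    (N : ℝ) * (⨅ Q : PeriodicConfiguration 3, Q.energyPerParticle lennardJones) +
        min g (711 / 5834000) *
          (Nat.card {j : Fin N // ¬ IsTwoShellGood (1 / 20) (47 / 50) 1 x j ∧
            ∃ i : Fin N, IsTwoShellGood (1 / 20) (47 / 50) 1 x i ∧ dist (x i) (x j) ≤ 21 / 20} : ℝ) ≤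
      interactionEnergy lennardJones x := by
  obtain ⟨K, f, hnet, hE⟩ := exists_netBound_core N x hx
  have hzinj : Function.Injective (x ∘ f) := hx.comp f.injective
  have hsep : ∀ k l : Fin K, k ≠ l → (3 / 10 : ℝ) ≤ dist (x (f k)) (x (f l)) :=
    sep_of_netBound (x ∘ f) hzinj hnet
  have hH := H K (x ∘ f) hzinj hnet
  have hcount := card_contact_le_strip x f hsep
  set m : ℝ := min g (711 / 5834000) with hm
  have hm0 : 0 ≤ m := le_min hg (by norm_num)
  have hmg : m ≤ g := min_le_left _ _
  have hm2 : m * 5833 ≤ 711 / 1000 := by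
    have : m ≤ 711 / 5834000 := min_le_right _ _
    linarith
  set tN : ℝ := (Nat.card {j : Fin N // ¬ IsTwoShellGood (1 / 20) (47 / 50) 1 x j ∧
      ∃ i : Fin N, IsTwoShellGood (1 / 20) (47 / 50) 1 x i ∧ dist (x i) (x j) ≤ 21 / 20} : ℝ) with htN
  set tK : ℝ := (Nat.card {k : Fin K // ¬ IsTwoShellGood (1 / 20) (47 / 50) 1 (x ∘ f) k ∧
      ∃ i : Fin K, IsTwoShellGood (1 / 20) (47 / 50) 1 (x ∘ f) i ∧
        dist ((x ∘ f) i) ((x ∘ f) k) ≤ 21 / 20} : ℝ) with htK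
  have htK0 : 0 ≤ tK := Nat.cast_nonneg _
  have hNK : 0 ≤ (N : ℝ) - K := by
    have : K ≤ N := by simpa using Fintype.card_le_of_embedding f
    have : (K : ℝ) ≤ N := by exact_mod_cast this
    linarith
  have h1 : m * tN ≤ m * tK + m * 5833 * ((N : ℝ) - K) := by
    have := mul_le_mul_of_nonneg_left hcount hm0
    nlinarith [this]
  have h2 : m * tK ≤ g * tK := mul_le_mul_of_nonneg_right hmg htK0
  have h3 : m * 5833 * ((N : ℝ) - K) ≤ (711 / 1000 : ℝ) * ((N : ℝ) - K) :=
    mul_le_mul_of_nonneg_right hm2 hNK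
  have hH' : (K : ℝ) * (⨅ Q : PeriodicConfiguration 3, Q.energyPerParticle lennardJones) + g * tK ≤
      interactionEnergy lennardJones (x ∘ f) := hH
  linarith [hE, hH', h1, h2, h3]

/-- **Separation is removable from the residual.**  If the residual's inequality holds with one
`g ≥ 0` for every `3/10`-SEPARATED injective configuration, then it holds with
`min g (711/5834000)` for every finite injective configuration. [folklore] -/
theorem tightContact_ineq_of_sep {g : ℝ} (hg : 0 ≤ g)
    (H : ∀ (K : ℕ) (z : Fin K → EuclideanSpace ℝ (Fin 3)),
      (∀ k l : Fin K, k ≠ l → (3 / 10 : ℝ) ≤ dist (z k) (z l)) →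
      (K : ℝ) * (⨅ Q : PeriodicConfiguration 3, Q.energyPerParticle lennardJones) +
          g * (Nat.card {k : Fin K // ¬ IsTwoShellGood (1 / 20) (47 / 50) 1 z k ∧
            ∃ i : Fin K, IsTwoShellGood (1 / 20) (47 / 50) 1 z i ∧ dist (z i) (z k) ≤ 21 / 20} : ℝ) ≤
        interactionEnergy lennardJones z)
    {N : ℕ} (x : Fin N → EuclideanSpace ℝ (Fin 3)) (hx : Function.Injective x) :
    (N : ℝ) * (⨅ Q : PeriodicConfiguration 3, Q.energyPerParticle lennardJones) +
        min g (711 / 5834000) *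
          (Nat.card {j : Fin N // ¬ IsTwoShellGood (1 / 20) (47 / 50) 1 x j ∧
            ∃ i : Fin N, IsTwoShellGood (1 / 20) (47 / 50) 1 x i ∧ dist (x i) (x j) ≤ 21 / 20} : ℝ) ≤
      interactionEnergy lennardJones x :=
  tightContact_ineq_of_netBound hg (fun K z hz hnet => H K z (sep_of_netBound z hz hnet)) x hx

/-- **The registered residual is equivalent to its single instance `δ = 3/10`** (and then holds with
a δ-independent constant). [folklore] -/
theorem tightContactGap_iff_sep :
    (∀ δ : ℝ, 0 < δ → ∃ g₂ : ℝ, 0 < g₂ ∧ ∀ (N : ℕ) (x : Fin N → EuclideanSpace ℝ (Fin 3)),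
      (∀ i j : Fin N, i ≠ j → δ ≤ dist (x i) (x j)) →
      (N : ℝ) * (⨅ Q : PeriodicConfiguration 3, Q.energyPerParticle lennardJones)
        + g₂ * (Nat.card {j : Fin N // ¬ IsTwoShellGood (1 / 20) (47 / 50) 1 x j ∧
            ∃ i : Fin N, IsTwoShellGood (1 / 20) (47 / 50) 1 x i ∧ dist (x i) (x j) ≤ 21 / 20} : ℝ)
        ≤ interactionEnergy lennardJones x) ↔
    (∃ g₂ : ℝ, 0 < g₂ ∧ ∀ (N : ℕ) (x : Fin N → EuclideanSpace ℝ (Fin 3)),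
      (∀ i j : Fin N, i ≠ j → (3 / 10 : ℝ) ≤ dist (x i) (x j)) →
      (N : ℝ) * (⨅ Q : PeriodicConfiguration 3, Q.energyPerParticle lennardJones)
        + g₂ * (Nat.card {j : Fin N // ¬ IsTwoShellGood (1 / 20) (47 / 50) 1 x j ∧
            ∃ i : Fin N, IsTwoShellGood (1 / 20) (47 / 50) 1 x i ∧ dist (x i) (x j) ≤ 21 / 20} : ℝ)
        ≤ interactionEnergy lennardJones x) := by
  constructor
  · intro h
    exact h (3 / 10) (by norm_num)
  · rintro ⟨g, hg, H⟩ δ hδ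
    refine ⟨min g (711 / 5834000), lt_min hg (by norm_num), fun N x hsep => ?_⟩
    exact tightContact_ineq_of_sep hg.le H x (fibre_injective_of_separated hδ hsep)

/-- **The registered residual is equivalent to its NET-BOUND instance**: it suffices to prove the
tight contact gap, with one `g₂ > 0`, for injective configurations all of whose particles have
negative half-repulsion functional `A_j < 0` (these are `3/10`-separated, uncrowded, and contain no
unbound particle). [folklore] -/
theorem tightContactGap_iff_netBound :
    (∀ δ : ℝ, 0 < δ → ∃ g₂ : ℝ, 0 < g₂ ∧ ∀ (N : ℕ) (x : Fin N → EuclideanSpace ℝ (Fin 3)),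
      (∀ i j : Fin N, i ≠ j → δ ≤ dist (x i) (x j)) →
      (N : ℝ) * (⨅ Q : PeriodicConfiguration 3, Q.energyPerParticle lennardJones)
        + g₂ * (Nat.card {j : Fin N // ¬ IsTwoShellGood (1 / 20) (47 / 50) 1 x j ∧
            ∃ i : Fin N, IsTwoShellGood (1 / 20) (47 / 50) 1 x i ∧ dist (x i) (x j) ≤ 21 / 20} : ℝ)
        ≤ interactionEnergy lennardJones x) ↔
    (∃ g₂ : ℝ, 0 < g₂ ∧ ∀ (N : ℕ) (x : Fin N → EuclideanSpace ℝ (Fin 3)), Function.Injective x →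
      (∀ j : Fin N, ∑ k ∈ Finset.univ.erase j,
        (min (lennardJones (dist (x j) (x k))) 0 + (1 / 2 : ℝ) * max (lennardJones (dist (x j) (x k))) 0) < 0) →
      (N : ℝ) * (⨅ Q : PeriodicConfiguration 3, Q.energyPerParticle lennardJones)
        + g₂ * (Nat.card {j : Fin N // ¬ IsTwoShellGood (1 / 20) (47 / 50) 1 x j ∧
            ∃ i : Fin N, IsTwoShellGood (1 / 20) (47 / 50) 1 x i ∧ dist (x i) (x j) ≤ 21 / 20} : ℝ)
        ≤ interactionEnergy lennardJones x) := by
  constructor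
  · intro h
    obtain ⟨g, hg, H⟩ := h (3 / 10) (by norm_num)
    exact ⟨g, hg, fun N x hx hnet => H N x (sep_of_netBound x hx hnet)⟩
  · rintro ⟨g, hg, H⟩ δ hδ
    refine ⟨min g (711 / 5834000), lt_min hg (by norm_num), fun N x hsep => ?_⟩
    exact tightContact_ineq_of_netBound hg.le H x (fibre_injective_of_separated hδ hsep)

/-- **The residual, once true, holds WITHOUT any separation hypothesis**: from the registered
residual (∀ δ form) one gets one `g₂ > 0` with `N·e* + g₂·#T(x) ≤ 𝓔_LJ(x)` for every finite
injective configuration. [folklore] -/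
theorem tightContact_ineq_of_tightContactGap
    (h : ∀ δ : ℝ, 0 < δ → ∃ g₂ : ℝ, 0 < g₂ ∧ ∀ (N : ℕ) (x : Fin N → EuclideanSpace ℝ (Fin 3)),
      (∀ i j : Fin N, i ≠ j → δ ≤ dist (x i) (x j)) →
      (N : ℝ) * (⨅ Q : PeriodicConfiguration 3, Q.energyPerParticle lennardJones)
        + g₂ * (Nat.card {j : Fin N // ¬ IsTwoShellGood (1 / 20) (47 / 50) 1 x j ∧
            ∃ i : Fin N, IsTwoShellGood (1 / 20) (47 / 50) 1 x i ∧ dist (x i) (x j) ≤ 21 / 20} : ℝ)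
        ≤ interactionEnergy lennardJones x) :
    ∃ g₂ : ℝ, 0 < g₂ ∧ ∀ (N : ℕ) (x : Fin N → EuclideanSpace ℝ (Fin 3)), Function.Injective x →
      (N : ℝ) * (⨅ Q : PeriodicConfiguration 3, Q.energyPerParticle lennardJones)
        + g₂ * (Nat.card {j : Fin N // ¬ IsTwoShellGood (1 / 20) (47 / 50) 1 x j ∧
            ∃ i : Fin N, IsTwoShellGood (1 / 20) (47 / 50) 1 x i ∧ dist (x i) (x j) ≤ 21 / 20} : ℝ)
        ≤ interactionEnergy lennardJones x := by
  obtain ⟨g, hg, H⟩ := h (3 / 10) (by norm_num)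
  exact ⟨min g (711 / 5834000), lt_min hg (by norm_num), fun N x hx =>
    tightContact_ineq_of_sep hg.le H x hx⟩

/-! ## §3 What this means for the crux and the target -/

/-- **The crux follows from the residual at the single separation `δ = 3/10`** (composition with
the landed `nearFarGlueR_of_tightContactGap`, p103560): conditional on that one inequality.
[folklore] -/
theorem nearFarGlueR_of_tightContactGap_sep
    (h : ∃ g₂ : ℝ, 0 < g₂ ∧ ∀ (N : ℕ) (x : Fin N → EuclideanSpace ℝ (Fin 3)),
      (∀ i j : Fin N, i ≠ j → (3 / 10 : ℝ) ≤ dist (x i) (x j)) →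
      (N : ℝ) * (⨅ Q : PeriodicConfiguration 3, Q.energyPerParticle lennardJones)
        + g₂ * (Nat.card {j : Fin N // ¬ IsTwoShellGood (1 / 20) (47 / 50) 1 x j ∧
            ∃ i : Fin N, IsTwoShellGood (1 / 20) (47 / 50) 1 x i ∧ dist (x i) (x j) ≤ 21 / 20} : ℝ)
        ≤ interactionEnergy lennardJones x) :
    NearFarGlueR :=
  nearFarGlueR_of_tightContactGap (tightContactGap_iff_sep.2 h)

/-- **The target is exactly all-bad bulk gap ∧ the residual at `δ = 3/10`** (composition with the
landed structure theorem `coerciveTwoShellGap_iff_allBadGap_and_tightContactGap`, p125405).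
[folklore] -/
theorem coerciveTwoShellGap_iff_allBadGap_and_tightContactGap_sep :
    CoerciveTwoShellGap ↔ AllBadGap ∧
      ∃ g₂ : ℝ, 0 < g₂ ∧ ∀ (N : ℕ) (x : Fin N → EuclideanSpace ℝ (Fin 3)),
        (∀ i j : Fin N, i ≠ j → (3 / 10 : ℝ) ≤ dist (x i) (x j)) →
        (N : ℝ) * (⨅ Q : PeriodicConfiguration 3, Q.energyPerParticle lennardJones)
          + g₂ * (Nat.card {j : Fin N // ¬ IsTwoShellGood (1 / 20) (47 / 50) 1 x j ∧
              ∃ i : Fin N, IsTwoShellGood (1 / 20) (47 / 50) 1 x i ∧ dist (x i) (x j) ≤ 21 / 20} : ℝ)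
          ≤ interactionEnergy lennardJones x := by
  rw [coerciveTwoShellGap_iff_allBadGap_and_tightContactGap, tightContactGap_iff_sep]

/-- **The crux as typed, at `δ = 3/10`**: `NearFarGlueR` is EXACTLY the statement that its two
antecedents yield the residual at the single separation `3/10` (composition of the landed
`nearFarGlueR_iff`, p107452, with `tightContactGap_iff_sep`). [folklore] -/
theorem nearFarGlueR_iff_sep :
    NearFarGlueR ↔ (FarFieldGapR → NearFieldConvexity →
      ∃ g₂ : ℝ, 0 < g₂ ∧ ∀ (N : ℕ) (x : Fin N → EuclideanSpace ℝ (Fin 3)),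
        (∀ i j : Fin N, i ≠ j → (3 / 10 : ℝ) ≤ dist (x i) (x j)) →
        (N : ℝ) * (⨅ Q : PeriodicConfiguration 3, Q.energyPerParticle lennardJones)
          + g₂ * (Nat.card {j : Fin N // ¬ IsTwoShellGood (1 / 20) (47 / 50) 1 x j ∧
              ∃ i : Fin N, IsTwoShellGood (1 / 20) (47 / 50) 1 x i ∧ dist (x i) (x j) ≤ 21 / 20} : ℝ)
          ≤ interactionEnergy lennardJones x) := by
  rw [nearFarGlueR_iff, tightContactGap_iff_sep]

/-- **The crux in terms of the two conjecture-grade engines**: since `FarFieldGapR ↔ AllBadGap`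
(sibling crux, `farFieldGapR_iff_allBadGap`), `NearFarGlueR` says exactly: all-bad bulk gap and near
field together yield the residual at `δ = 3/10`. [folklore] -/
theorem nearFarGlueR_iff_allBadGap_sep :
    NearFarGlueR ↔ (AllBadGap → NearFieldConvexity →
      ∃ g₂ : ℝ, 0 < g₂ ∧ ∀ (N : ℕ) (x : Fin N → EuclideanSpace ℝ (Fin 3)),
        (∀ i j : Fin N, i ≠ j → (3 / 10 : ℝ) ≤ dist (x i) (x j)) →
        (N : ℝ) * (⨅ Q : PeriodicConfiguration 3, Q.energyPerParticle lennardJones)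
          + g₂ * (Nat.card {j : Fin N // ¬ IsTwoShellGood (1 / 20) (47 / 50) 1 x j ∧
              ∃ i : Fin N, IsTwoShellGood (1 / 20) (47 / 50) 1 x i ∧ dist (x i) (x j) ≤ 21 / 20} : ℝ)
          ≤ interactionEnergy lennardJones x) := by
  rw [nearFarGlueR_iff_sep, PhononSlackCertificatesFarFieldGapR.farFieldGapR_iff_allBadGap]

/-- **Registered sub-goal `stub_looseReduction` of the crux item** (skeleton `Lines/Sketch.lean`,
c3): the residual is equivalent to its net-bound instance — `tightContactGap_iff_netBound` in
closed form. [folklore] -/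
theorem stub_looseReduction :
    ((∀ δ : ℝ, 0 < δ → ∃ g₂ : ℝ, 0 < g₂ ∧ ∀ (N : ℕ) (x : Fin N → EuclideanSpace ℝ (Fin 3)),
      (∀ i j : Fin N, i ≠ j → δ ≤ dist (x i) (x j)) →
      (N : ℝ) * (⨅ Q : PeriodicConfiguration 3, Q.energyPerParticle lennardJones)
        + g₂ * (Nat.card {j : Fin N // ¬ IsTwoShellGood (1 / 20) (47 / 50) 1 x j ∧
            ∃ i : Fin N, IsTwoShellGood (1 / 20) (47 / 50) 1 x i ∧ dist (x i) (x j) ≤ 21 / 20} : ℝ)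
        ≤ interactionEnergy lennardJones x) ↔
    (∃ g₂ : ℝ, 0 < g₂ ∧ ∀ (N : ℕ) (x : Fin N → EuclideanSpace ℝ (Fin 3)), Function.Injective x →
      (∀ j : Fin N, ∑ k ∈ Finset.univ.erase j,
        (min (lennardJones (dist (x j) (x k))) 0 + (1 / 2 : ℝ) * max (lennardJones (dist (x j) (x k))) 0) < 0) →
      (N : ℝ) * (⨅ Q : PeriodicConfiguration 3, Q.energyPerParticle lennardJones)
        + g₂ * (Nat.card {j : Fin N // ¬ IsTwoShellGood (1 / 20) (47 / 50) 1 x j ∧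
            ∃ i : Fin N, IsTwoShellGood (1 / 20) (47 / 50) 1 x i ∧ dist (x i) (x j) ≤ 21 / 20} : ℝ)
        ≤ interactionEnergy lennardJones x)) :=
  tightContactGap_iff_netBound

end Summit.AtomisticToContinuum.Crystallization.Theorems.PhononSlackCertificatesNearFarGlueR

end
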